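import Literature.IUT.HodgeTheaters.PiAvatarNFKitSlots
import Literature.IUT.HodgeTheaters.InitialThetaDataArrowOpenProofs
import HarnessLib

/-!
# Automorphisms of `𝒟^⊚` that lift to `𝒟_v̲ = ℬ(Π_{X̲→_v̲})⁰` have trivial `𝔽_l^⋇`-character — [IUTchI] Def 4.1 (ii) «`†η_v` … constructed
# solely from `†𝒟_v`» at the genuine data, FROM abc-iut-L5-t1's typed §1 claims (GAP-LEDGER G-L5t3g5-1 = NFK-5, DISCHARGED modulo
# `ArrowCoveringClaims`; proof-only, post-freeze additive D13, not a cone member)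

S. Mochizuki, *Inter-universal Teichmüller theory I*, kurims manuscript (May 2020), §1 pp. 37–38 (the construction of `X̲→`: `Δ_X̲ ↠ Δ_ε`
kills «the inertia groups of all nonzero cusps ≠ ε′, ε″», `Δ_ε ↠ Δ_ε⁺`, `Π_{X̲→}`), Def 4.1 (ii) p. 96 l. 20–26 («one may construct, solely
from `†𝒟_v`, a canonical element `†η_v ∈ LabCusp(†𝒟_v)` determined by `ε_v` … from Corollary 1.2 for `v ∈ V^good ∩ V^non`»), Rmk 4.2.1
p. 98 (this FAILS for `ℬ(C_v)⁰`), Ex 4.5 (ii) p. 108 («`[ε] ↦ η_v`») ([IUTchI] Def 4.1 (ii) p.96) [claim: Mochizuki2012, status: disputed]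
(D-0012 claim key, series status DISPUTED — kernel theorems over abc-iut-L5-t2's REAL `InitialThetaData`, abc-iut-L5-t1's `CuspGalois` and
typed §1 claims `hA : D.geom.pe.ArrowCoveringClaims` (the standing hypothesis of the (β)-chain), abc-iut-L5-t4's binder
`hS : D.CuspClassesNormaliserStable`; nothing of the series is asserted, no side is taken on [IUTchIII] Cor. 3.12).

THE ARGUMENT (abc-iut-L5-t3; why the `X̲→`-structure is exactly the input, cf. Rmk 4.2.1).  Call a cusp `x` of `X̲_K` SPLIT if its
inertia group lies in `Δ_{X̲→} := Π_{X̲→_K} ∩ Δ_C` (it splits completely in `X̲→ → X̲`).  By the DEFINITION of `Π_{X̲→}` every nonzero cusp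
`≠ ε′, ε″` is split (`deltaEpsKer` kills its inertia; unconditional), while `ε′, ε″` are NOT split under `hA` (`inertia_ε1_sup`:
`I_{ε′} ⊔ jKer = Δ_X̲` with `[Δ_X̲ : jKer] = l ≠ 1`, and `Δ_{X̲→} = jKer`, t2's `PiXarrow_inf_deltaC_of_arrowCoveringClaims`).  An
`n ∈ N(Π_{X̲_K})` normalising `Δ_{X̲→}` (e.g. `n ∈ N(Π_v̲)`: `Δ_{X̲→} = Π_v̲ ∩ Δ_C`) permutes the split cusps (`actF_decomp`: `I_{n·x}` is a
`Π_{X̲_K}`-conjugate of `n I_x n⁻¹`, and `Π_{X̲_K} ≤ Π_{C̲_K}` normalises `jKer` — `hA.jKer_normal`), hence the non-split ones; if it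
also fixes `ε⁰` (i.e. descends to `𝒟^⊚`, `mem_normalizer_PiCund_iff_actF_ε0`) it maps `ε′ ↦ ε′` or `ε″`, and by LINEARITY
(`gChart₀Model_actF_nf`: `z ↦ u z`) `u = gChart₀(n·ε′) = ±1`.  So **`toFlStarNF = 1` for every automorphism of `𝒟^⊚` that lifts along
`φ^NF_{•,v̲}` to `𝒟_v̲`** — the law G-L5t3g5-1 required by the NFKit slot `labPull` (PiAvatarNFKitSlots), now a THEOREM modulo `hA`.
Proof-only; no instance/notation; typed ≠ proved elsewhere.
-/

noncomputable section

namespace Literature.IUT.HodgeTheaters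

open CategoryTheory
open scoped Pointwise

universe u v w

section NFLocalCharacter

variable {F : Type u} {K : Type v} {Fbar : Type w} [Field F] [NumberField F] [Field K] [NumberField K]
  [Algebra F K] [Field Fbar] [Algebra F Fbar] [Algebra K Fbar]
  {E : WeierstrassCurve F} [E.IsElliptic] {l : ℕ} {Pb : BadPlacePredicates K}
  (D : InitialThetaData F K Fbar E l Pb) (CG : D.geom.pe.CuspGalois) (hS : D.CuspClassesNormaliserStable)

namespace InitialThetaData

/-! ### Split cusps: inertia inside `Δ_{X̲→} = Π_{X̲→_K} ∩ Δ_C` -/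

/-- **Every nonzero cusp `≠ ε′, ε″` is split** — its inertia group lies in `Δ_{X̲→} := Π_{X̲→_K} ∩ Δ_C` — by the very DEFINITION of
`Π_{X̲→}` (p. 37: `Δ_ε` is `Δ_X̲^{ab} ⊗ 𝔽_l` modulo «the images of the inertia groups of all nonzero cusps `≠ ε′, ε″`»; t1's `deltaEpsKer ≤
jKer ≤ Π_{X̲→} ∩ Δ`, t2's transport `map_jKer_le_PiXarrow_inf_deltaC`).  Unconditional. ([IUTchI] §1 p.37) [claim: Mochizuki2012, status: disputed] -/
theorem inertia_map_le_arrowDelta_of_ne {x : D.geom.pe.Cusp} (h0 : x ≠ D.geom.pe.ε0) (h1 : x ≠ D.geom.pe.ε1)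
    (h2 : x ≠ D.geom.pe.ε2) : (D.geom.pe.inertia x).map D.geom.embK ≤ D.PiXarrow ⊓ D.DeltaC := by
  have hde : D.geom.pe.inertia x ≤ D.geom.pe.deltaEpsKer := by
    rw [PuncturedEllipticData.deltaEpsKer]
    exact le_sup_of_le_right (le_iSup (fun y : {y : D.geom.pe.Cusp //
      D.geom.pe.IsNonzeroCusp y ∧ y ≠ D.geom.pe.ε1 ∧ y ≠ D.geom.pe.ε2} => D.geom.pe.inertia y.1) ⟨x, h0, h1, h2⟩)
  have hj : D.geom.pe.deltaEpsKer ≤ D.geom.pe.jKer := by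
    rw [PuncturedEllipticData.jKer]
    exact le_sup_left
  exact (Subgroup.map_mono (hde.trans hj)).trans D.map_jKer_le_PiXarrow_inf_deltaC

/-- **`ε′` is NOT split** (under `hA`): `I_{ε′} ⊔ jKer = Δ_X̲` (`inertia_ε1_sup`) with `[Δ_X̲ : jKer] = l ≥ 5` (`jKer_relindex`), and
`Δ_{X̲→} = embK(jKer)` (`piXarrow_inf_delta`, transported). ([IUTchI] §1 p.38) [claim: Mochizuki2012, status: disputed] -/
theorem not_inertia_ε1_map_le_arrowDelta (hA : D.geom.pe.ArrowCoveringClaims) :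
    ¬ (D.geom.pe.inertia D.geom.pe.ε1).map D.geom.embK ≤ D.PiXarrow ⊓ D.DeltaC := by
  intro h
  rw [D.PiXarrow_inf_deltaC_of_arrowCoveringClaims hA, Subgroup.map_le_map_iff_of_injective D.geom.embK_injective] at h
  have hsup := hA.inertia_ε1_sup
  rw [sup_eq_right.mpr h] at hsup
  have hidx := hA.jKer_relindex
  rw [hsup, Subgroup.relIndex_self] at hidx
  have := D.geom.pe.five_le
  omega

/-- **`ε″` is NOT split** (under `hA`; `inertia_ε2_sup`). ([IUTchI] §1 p.38) [claim: Mochizuki2012, status: disputed] -/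
theorem not_inertia_ε2_map_le_arrowDelta (hA : D.geom.pe.ArrowCoveringClaims) :
    ¬ (D.geom.pe.inertia D.geom.pe.ε2).map D.geom.embK ≤ D.PiXarrow ⊓ D.DeltaC := by
  intro h
  rw [D.PiXarrow_inf_deltaC_of_arrowCoveringClaims hA, Subgroup.map_le_map_iff_of_injective D.geom.embK_injective] at h
  have hsup := hA.inertia_ε2_sup
  rw [sup_eq_right.mpr h] at hsup
  have hidx := hA.jKer_relindex
  rw [hsup, Subgroup.relIndex_self] at hidx
  have := D.geom.pe.five_le
  omega

/-- Hence (under `hA`) a NONZERO cusp is split iff it is neither `ε′` nor `ε″`. ([IUTchI] §1 p.38) [claim: Mochizuki2012, status: disputed] -/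
theorem inertia_map_le_arrowDelta_iff (hA : D.geom.pe.ArrowCoveringClaims) {x : D.geom.pe.Cusp} (h0 : x ≠ D.geom.pe.ε0) :
    (D.geom.pe.inertia x).map D.geom.embK ≤ D.PiXarrow ⊓ D.DeltaC ↔ x ≠ D.geom.pe.ε1 ∧ x ≠ D.geom.pe.ε2 := by
  constructor
  · intro h
    constructor
    · rintro rfl; exact D.not_inertia_ε1_map_le_arrowDelta hA h
    · rintro rfl; exact D.not_inertia_ε2_map_le_arrowDelta hA h
  · rintro ⟨h1, h2⟩
    exact D.inertia_map_le_arrowDelta_of_ne h0 h1 h2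

/-! ### `Π_{C̲_K}` normalises `Δ_{X̲→}`; normalisers of `Δ_{X̲→}` permute the split cusps -/

/-- `Π_{C̲_K} = embK(Π_C̲)` normalises `Δ_{X̲→} = embK(jKer)` (`hA.jKer_normal`: `jKer ⊴ Π_C̲`). ([IUTchI] §1 p.38) [claim: Mochizuki2012, status: disputed] -/
theorem conj_mem_arrowDelta_of_mem_PiCund (hA : D.geom.pe.ArrowCoveringClaims) {c : D.PiC} (hc : c ∈ D.PiCund) {z : D.PiC}
    (hz : z ∈ D.PiXarrow ⊓ D.DeltaC) : c * z * c⁻¹ ∈ D.PiXarrow ⊓ D.DeltaC := by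
  rw [D.PiXarrow_inf_deltaC_of_arrowCoveringClaims hA] at hz ⊢
  obtain ⟨c', hc', rfl⟩ := Subgroup.mem_map.mp hc
  obtain ⟨j, hj, rfl⟩ := Subgroup.mem_map.mp hz
  have hjC : j ∈ D.geom.pe.PiCbar :=
    (Subgroup.mem_inf.mp (Subgroup.mem_inf.mp (D.geom.pe.jKer_le_deltaXbar hj)).1).2
  haveI := hA.jKer_normal
  have hconj : (⟨c', hc'⟩ * ⟨j, hjC⟩ * ⟨c', hc'⟩⁻¹ : ↥D.geom.pe.PiCbar) ∈ D.geom.pe.jKer.subgroupOf D.geom.pe.PiCbar :=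
    Subgroup.Normal.conj_mem inferInstance ⟨j, hjC⟩ (Subgroup.mem_subgroupOf.mpr hj) ⟨c', hc'⟩
  rw [Subgroup.mem_subgroupOf] at hconj
  rw [← map_mul, ← map_inv, ← map_mul]
  exact Subgroup.mem_map_of_mem _ hconj

/-- `Π_{C̲_K}` normalises `Δ_{X̲→}`, as an iff. ([IUTchI] §1 p.38) [claim: Mochizuki2012, status: disputed] -/
theorem conj_mem_arrowDelta_iff_of_mem_PiCund (hA : D.geom.pe.ArrowCoveringClaims) {c : D.PiC} (hc : c ∈ D.PiCund) (z : D.PiC) :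
    z ∈ D.PiXarrow ⊓ D.DeltaC ↔ c * z * c⁻¹ ∈ D.PiXarrow ⊓ D.DeltaC := by
  refine ⟨D.conj_mem_arrowDelta_of_mem_PiCund hA hc, fun h => ?_⟩
  have h' := D.conj_mem_arrowDelta_of_mem_PiCund hA (D.PiCund.inv_mem hc) h
  simpa [mul_assoc] using h'

/-- **Normalisers of `Δ_{X̲→}` permute the split cusps**: for `n ∈ N(Π_{X̲_K})` normalising `Δ_{X̲→}`, if `x` is split then so is `n·x`
(`actF_decomp`: `embK(D_{n·x}) = (t n)·embK(D_x)·(t n)⁻¹` with `t ∈ Π_{X̲_K}`; intersect with `Δ_C ⊴ Π_{C_F}`; `t` normalises `Δ_{X̲→}` by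
`jKer ⊴ Π_C̲`). ([IUTchI] Def 4.1 (ii) p.96) [claim: Mochizuki2012, status: disputed] -/
theorem inertia_map_le_arrowDelta_actF (hA : D.geom.pe.ArrowCoveringClaims)
    (n : ↥(Subgroup.normalizer ((D.PiXund : Subgroup D.PiC) : Set D.PiC)))
    (hJ : ∀ z : D.PiC, z ∈ D.PiXarrow ⊓ D.DeltaC ↔ (n : D.PiC) * z * (n : D.PiC)⁻¹ ∈ D.PiXarrow ⊓ D.DeltaC) {x : D.geom.pe.Cusp}
    (hx : (D.geom.pe.inertia x).map D.geom.embK ≤ D.PiXarrow ⊓ D.DeltaC) :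
    (D.geom.pe.inertia (D.actF CG hS n x)).map D.geom.embK ≤ D.PiXarrow ⊓ D.DeltaC := by
  obtain ⟨t, ht, hconj⟩ := D.actF_decomp CG hS n x
  have hN : D.DeltaC.Normal := Literature.AnabelianGeometry.AbsoluteAnabelian.FundamentalExtension.normal_geom _
  rintro _ ⟨i, hi, rfl⟩
  obtain ⟨hiD, hiΔ⟩ := Subgroup.mem_inf.mp hi
  -- `embK i ∈ embK(D_{n·x}) = (t n)·embK(D_x)·(t n)⁻¹`, so `(t n)⁻¹·embK i·(t n) = embK d` with `d ∈ D_x`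
  have hmem : D.geom.embK i ∈ MulAut.conj (t * (n : D.PiC)) • (D.geom.pe.decomp x).map D.geom.embK := by
    rw [hconj]; exact Subgroup.mem_map_of_mem _ hiD
  rw [Subgroup.mem_pointwise_smul_iff_inv_smul_mem, MulAut.smul_def, MulAut.conj_inv_apply] at hmem
  obtain ⟨d, hd, hdeq⟩ := Subgroup.mem_map.mp hmem
  -- `d ∈ Δ_{C_K}` since `Δ_C ⊴ Π_{C_F}`, hence `d ∈ I_x` and `embK d ∈ Δ_{X̲→}`
  have hwΔ : (t * (n : D.PiC))⁻¹ * D.geom.embK i * (t * (n : D.PiC)) ∈ D.DeltaC :=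
    hN.conj_mem' _ ((D.embK_mem_deltaC_iff i).mpr hiΔ) _
  have hdΔ : D.geom.embK d ∈ D.DeltaC := by rw [hdeq]; exact hwΔ
  have hdI : d ∈ D.geom.pe.inertia x := Subgroup.mem_inf.mpr ⟨hd, (D.embK_mem_deltaC_iff d).mp hdΔ⟩
  have hdJ : D.geom.embK d ∈ D.PiXarrow ⊓ D.DeltaC := hx (Subgroup.mem_map_of_mem _ hdI)
  -- `t n` normalises `Δ_{X̲→}` (`n` by hypothesis, `t ∈ Π_{X̲_K} ≤ Π_{C̲_K}` by `jKer ⊴ Π_C̲`)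
  have h1 := (hJ _).mp hdJ
  have h2 := D.conj_mem_arrowDelta_of_mem_PiCund hA (D.PiXund_le_PiCund ht) h1
  rw [hdeq] at h2
  have e : t * ((n : D.PiC) * ((t * (n : D.PiC))⁻¹ * D.geom.embK i * (t * (n : D.PiC))) * (n : D.PiC)⁻¹) * t⁻¹ =
      D.geom.embK i := by group
  rw [e] at h2
  exact h2

/-! ### The character of a lifting automorphism is trivial -/

variable [Fact l.Prime]

/-- **An automorphism of `𝒟^{⊚±}` that fixes `ε⁰` and normalises `Δ_{X̲→}` has slope `±1`**: it permutes the split cusps (for `n` and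
`n⁻¹`), hence the non-split nonzero cusps `{ε′, ε″}`, and it is LINEAR `z ↦ u z` in the chart based at `ε⁰`, so `u = gChart₀(n·ε′) = ±1`.
([IUTchI] Def 4.1 (ii) p.96) [claim: Mochizuki2012, status: disputed] -/
theorem actFSlope_eq_one_or_eq_neg_one_of_normalizes_arrowDelta (hA : D.geom.pe.ArrowCoveringClaims)
    (n : ↥(Subgroup.normalizer ((D.PiXund : Subgroup D.PiC) : Set D.PiC)))
    (h0 : D.actF CG hS n D.geom.pe.ε0 = D.geom.pe.ε0)
    (hJ : ∀ z : D.PiC, z ∈ D.PiXarrow ⊓ D.DeltaC ↔ (n : D.PiC) * z * (n : D.PiC)⁻¹ ∈ D.PiXarrow ⊓ D.DeltaC) :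
    D.actFSlope CG hS n = 1 ∨ D.actFSlope CG hS n = -1 := by
  -- `hJ` for `n⁻¹`
  have hJ' : ∀ z : D.PiC, z ∈ D.PiXarrow ⊓ D.DeltaC ↔
      ((n⁻¹ : ↥(Subgroup.normalizer ((D.PiXund : Subgroup D.PiC) : Set D.PiC))) : D.PiC) * z *
        ((n⁻¹ : ↥(Subgroup.normalizer ((D.PiXund : Subgroup D.PiC) : Set D.PiC))) : D.PiC)⁻¹ ∈ D.PiXarrow ⊓ D.DeltaC := by
    intro z
    have h := hJ ((n : D.PiC)⁻¹ * z * (n : D.PiC))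
    have e : (n : D.PiC) * ((n : D.PiC)⁻¹ * z * (n : D.PiC)) * (n : D.PiC)⁻¹ = z := by group
    rw [e] at h
    rw [Subgroup.coe_inv, inv_inv]
    exact h.symm
  -- `y := n·ε′` is a non-split nonzero cusp
  set y := D.actF CG hS n D.geom.pe.ε1 with hy
  have hy0 : y ≠ D.geom.pe.ε0 := by
    intro h
    have h' : D.actF CG hS n D.geom.pe.ε1 = D.actF CG hS n D.geom.pe.ε0 := by rw [← hy, h, h0]
    exact D.geom.pe.ε1_ne_ε0 ((D.actF CG hS n).injective h')
  have hysplit : ¬ (D.geom.pe.inertia y).map D.geom.embK ≤ D.PiXarrow ⊓ D.DeltaC := by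
    intro hle
    have h := D.inertia_map_le_arrowDelta_actF CG hS hA n⁻¹ hJ' hle
    rw [hy, ← Equiv.Perm.mul_apply, ← map_mul, inv_mul_cancel, map_one, Equiv.Perm.one_apply] at h
    exact D.not_inertia_ε1_map_le_arrowDelta hA h
  have hy12 : y = D.geom.pe.ε1 ∨ y = D.geom.pe.ε2 := by
    by_contra hne
    push Not at hne
    exact hysplit ((D.inertia_map_le_arrowDelta_iff hA hy0).mpr hne)
  -- linearity: `gChart₀ y = slope`
  have hlin : D.gChart₀Model CG y = D.actFSlope CG hS n := by
    rw [hy, D.gChart₀Model_actF CG hS n, h0, D.gChart₀Model_ε0 CG, D.gChart₀Model_ε1 CG, mul_one, add_zero]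
  rcases hy12 with h | h
  · left; rw [← hlin, h, D.gChart₀Model_ε1 CG]
  · right; rw [← hlin, h, D.gChart₀Model_ε2 CG]

omit [Fact l.Prime] in
/-- `N(Π_v̲)` normalises `Δ_{X̲→}`: `Δ_{X̲→} = Π_v̲ ∩ Δ_C` for `Π_v̲ = Π_{X̲→_K} ∩ augGF⁻¹(G_v̲)` (`Δ_C ⊆ augGF⁻¹(G_v̲)`), and `Δ_C ⊴ Π_{C_F}`.
([IUTchI] Def 3.1 (e) p.62) [claim: Mochizuki2012, status: disputed] -/
theorem conj_mem_arrowDelta_iff_of_mem_normalizer_loc (Gv : Subgroup (Fbar ≃ₐ[F] Fbar)) {m : D.PiC}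
    (hv : m ∈ Subgroup.normalizer ((D.PiXarrow ⊓ Gv.comap D.augGF : Subgroup D.PiC) : Set D.PiC)) (z : D.PiC) :
    z ∈ D.PiXarrow ⊓ D.DeltaC ↔ m * z * m⁻¹ ∈ D.PiXarrow ⊓ D.DeltaC := by
  have hN : D.DeltaC.Normal := Literature.AnabelianGeometry.AbsoluteAnabelian.FundamentalExtension.normal_geom _
  have hΔ : ∀ w : D.PiC, w ∈ D.DeltaC → w ∈ Gv.comap D.augGF := by
    intro w hw
    rw [Subgroup.mem_comap, (D.augGF_eq_one_iff w).mpr hw]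
    exact Gv.one_mem
  have hv' := Subgroup.mem_normalizer_iff.mp hv z
  constructor
  · intro hz
    obtain ⟨hz1, hz2⟩ := Subgroup.mem_inf.mp hz
    have h := (hv'.mp (Subgroup.mem_inf.mpr ⟨hz1, hΔ z hz2⟩))
    exact Subgroup.mem_inf.mpr ⟨(Subgroup.mem_inf.mp h).1, hN.conj_mem z hz2 m⟩
  · intro hz
    obtain ⟨hz1, hz2⟩ := Subgroup.mem_inf.mp hz
    have hzΔ : z ∈ D.DeltaC := by
      have h := hN.conj_mem _ hz2 m⁻¹
      simpa [mul_assoc] using h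
    have h := hv'.mpr (Subgroup.mem_inf.mpr ⟨hz1, hΔ _ hz2⟩)
    exact Subgroup.mem_inf.mpr ⟨(Subgroup.mem_inf.mp h).1, hzΔ⟩

/-- **G-L5t3g5-1 (NFK-5), DISCHARGED modulo `hA`: an automorphism of `𝒟^⊚` that LIFTS along `φ^NF_{•,v̲}` to an automorphism of
`𝒟_v̲ = ℬ(Π_v̲)⁰` — i.e. is induced by `m ∈ N(Π_{C̲_K}) ∩ N(Π_v̲)` — has `toFlStarNF = 1`** ([IUTchI] Def 4.1 (ii): `†η_v` is canonical,
constructed from `†𝒟_v` via Cor 1.2; Ex 4.5 (ii) `[ε] ↦ η_v`; Rmk 4.2.1: the `X̲→_v̲`-structure is what makes this true).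
([IUTchI] Def 4.1 (ii) p.96) [claim: Mochizuki2012, status: disputed] -/
theorem toFlStarNF_eq_one_of_mem_normalizer_loc (hA : D.geom.pe.ArrowCoveringClaims) (Gv : Subgroup (Fbar ≃ₐ[F] Fbar)) {m : D.PiC}
    (hv : m ∈ Subgroup.normalizer ((D.PiXarrow ⊓ Gv.comap D.augGF : Subgroup D.PiC) : Set D.PiC))
    (hC : m ∈ Subgroup.normalizer ((D.PiCund : Subgroup D.PiC) : Set D.PiC)) :
    D.toFlStarNF CG hS (OrbitCat.autOfNormalizer m hC) = 1 := by
  rw [D.toFlStarNF_autOfNormalizer CG hS, inv_eq_one, FlStar.mk_eq_one_iff]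
  have h := D.actFSlope_eq_one_or_eq_neg_one_of_normalizes_arrowDelta CG hS hA (D.nfNormalizerIncl ⟨m, hC⟩)
    (D.actF_nf_ε0 CG hS ⟨m, hC⟩) (D.conj_mem_arrowDelta_iff_of_mem_normalizer_loc Gv hv)
  rcases h with h | h
  · exact Or.inl (Units.ext h)
  · exact Or.inr (Units.ext h)

/-- … hence such an automorphism acts TRIVIALLY on `LabCusp(𝒟^⊚)` and in particular fixes the class `[ε̲]` — the kernel form of
«`[ε] ↦ η_v` is natural in `†𝒟_v`» (Ex 4.5 (i)(ii)). ([IUTchI] Ex 4.5 (ii) p.108) [claim: Mochizuki2012, status: disputed] -/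
theorem gLabNFAutModel_eq_one_of_mem_normalizer_loc (hA : D.geom.pe.ArrowCoveringClaims) (Gv : Subgroup (Fbar ≃ₐ[F] Fbar))
    {m : D.PiC} (hv : m ∈ Subgroup.normalizer ((D.PiXarrow ⊓ Gv.comap D.augGF : Subgroup D.PiC) : Set D.PiC))
    (hC : m ∈ Subgroup.normalizer ((D.PiCund : Subgroup D.PiC) : Set D.PiC)) :
    D.gLabNFAutModel CG hS (OrbitCat.autOfNormalizer m hC) = 1 :=
  D.gLabNFAutModel_eq_one_of_toFlStarNF_eq_one CG hS (D.toFlStarNF_eq_one_of_mem_normalizer_loc CG hS hA Gv hv hC)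

/-- The GLOBAL form: an automorphism of `𝒟^⊚` induced by an element normalising `Π_{X̲→_K}` itself (an automorphism of `X̲→_K` over
`C̲_K`) also has trivial character. ([IUTchI] Def 4.1 (ii) p.96) [claim: Mochizuki2012, status: disputed] -/
theorem toFlStarNF_eq_one_of_mem_normalizer_PiXarrow (hA : D.geom.pe.ArrowCoveringClaims) {m : D.PiC}
    (hX : m ∈ Subgroup.normalizer ((D.PiXarrow : Subgroup D.PiC) : Set D.PiC))
    (hC : m ∈ Subgroup.normalizer ((D.PiCund : Subgroup D.PiC) : Set D.PiC)) :
    D.toFlStarNF CG hS (OrbitCat.autOfNormalizer m hC) = 1 := by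
  have hN : D.DeltaC.Normal := Literature.AnabelianGeometry.AbsoluteAnabelian.FundamentalExtension.normal_geom _
  rw [D.toFlStarNF_autOfNormalizer CG hS, inv_eq_one, FlStar.mk_eq_one_iff]
  have hJ : ∀ z : D.PiC, z ∈ D.PiXarrow ⊓ D.DeltaC ↔ m * z * m⁻¹ ∈ D.PiXarrow ⊓ D.DeltaC := by
    intro z
    have hX' := Subgroup.mem_normalizer_iff.mp hX z
    constructor
    · intro hz
      obtain ⟨hz1, hz2⟩ := Subgroup.mem_inf.mp hz
      exact Subgroup.mem_inf.mpr ⟨hX'.mp hz1, hN.conj_mem z hz2 m⟩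
    · intro hz
      obtain ⟨hz1, hz2⟩ := Subgroup.mem_inf.mp hz
      have hzΔ : z ∈ D.DeltaC := by
        have h := hN.conj_mem _ hz2 m⁻¹
        simpa [mul_assoc] using h
      exact Subgroup.mem_inf.mpr ⟨hX'.mpr hz1, hzΔ⟩
  have h := D.actFSlope_eq_one_or_eq_neg_one_of_normalizes_arrowDelta CG hS hA (D.nfNormalizerIncl ⟨m, hC⟩)
    (D.actF_nf_ε0 CG hS ⟨m, hC⟩) hJ
  rcases h with h | h
  · exact Or.inl (Units.ext h)
  · exact Or.inr (Units.ext h)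

end InitialThetaData

end NFLocalCharacter

end Literature.IUT.HodgeTheaters
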